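import Literature.Computability.QuantumComplexity.RevSLPSteps
import HarnessLib

/-!
# Reversible arithmetic gadgets, III: multiplication as a straight-line program

Topic `Literature/Computability/QuantumComplexity`; sequel of `RevSLP.lean`/`RevSLPSteps.lean`. Schoolbook multiplication
(Vedral–Barenco–Ekert 1996, §3.3: repeated shifted addition of the multiplicand controlled by the bits
of the multiplier) as a *macro* of the straight-line register language: for a block of `2Wd + 1`
fresh registers starting at `r₀` and sources `x ≠ y` below `r₀`,

  `acc₀ = r₀` (never written, value `0`), `ppᵢ = r₀ + 2i + 1 := [bit i of x]·y`,
  `accᵢ₊₁ = r₀ + 2i + 2 := accᵢ + ppᵢ·2^i (mod 2^Wd)`,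

so that `acc_{Wd} = r₀ + 2Wd` holds `x·y mod 2^{Wd}` (`SLP.run_mulInstrs`); the macro is well
shaped (`SLP.shape_of_mem_mulInstrs`) and writes exactly the registers `r₀ + 1, …, r₀ + 2Wd`
(`SLP.mem_filterMap_rdest_mulInstrs`, `SLP.nodup_filterMap_rdest_mulInstrs`,
`SLP.filterMap_fdest_mulInstrs`), leaving all other registers and all flags alone.

## References

* V. Vedral, A. Barenco, A. Ekert, *Quantum networks for elementary arithmetic operations*,
  Phys. Rev. A 54 (1996), §3.3 [VedralBarencoEkert1996].
-/

namespace Literature.Computability.QuantumComplexity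

namespace SLP

open Function

/-- The first `i` rows of the multiplication macro. [cite: VedralBarencoEkert1996, §3.3] -/
def mulInstrsUpTo (r₀ x y : ℕ) : ℕ → List Instr
  | 0 => []
  | i + 1 => mulInstrsUpTo r₀ x y i ++ [.andBit (r₀ + 2 * i + 1) x i y, .add (r₀ + 2 * i + 2) (r₀ + 2 * i) (r₀ + 2 * i + 1) i]

/-- **The multiplication macro** `r₀ + 2Wd := x·y mod 2^{Wd}` (all `Wd` rows). [cite: VedralBarencoEkert1996, §3.3] -/
def mulInstrs (Wd r₀ x y : ℕ) : List Instr := mulInstrsUpTo r₀ x y Wd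

/-- Partial products: `y · (x mod 2^i) + [x_i]·y·2^i = y · (x mod 2^{i+1})`. [folklore] -/
theorem mul_mod_two_pow_succ (x y i : ℕ) :
    y * (x % 2 ^ i) + (if x.testBit i then y else 0) * 2 ^ i = y * (x % 2 ^ (i + 1)) := by
  rw [Nat.mod_pow_succ, ← Nat.toNat_testBit, mul_add]
  cases x.testBit i <;> simp [mul_comm]

/-- The length of the macro. [folklore] -/
theorem length_mulInstrsUpTo (r₀ x y : ℕ) : ∀ i, (mulInstrsUpTo r₀ x y i).length = 2 * i
  | 0 => rfl
  | i + 1 => by rw [mulInstrsUpTo, List.length_append, length_mulInstrsUpTo r₀ x y i]; simp; ring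

/-- The registers written by the macro. [folklore] -/
theorem mem_filterMap_rdest_mulInstrsUpTo (r₀ x y : ℕ) : ∀ (i d : ℕ),
    d ∈ (mulInstrsUpTo r₀ x y i).filterMap Instr.rdest ↔ ∃ j, 1 ≤ j ∧ j ≤ 2 * i ∧ d = r₀ + j
  | 0, d => by simp [mulInstrsUpTo]
  | i + 1, d => by
    rw [mulInstrsUpTo, List.filterMap_append, List.mem_append, mem_filterMap_rdest_mulInstrsUpTo r₀ x y i d]
    simp only [List.filterMap_cons, Instr.rdest, List.filterMap_nil, List.mem_cons, List.not_mem_nil, or_false]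
    constructor
    · rintro (⟨j, h1, h2, rfl⟩ | rfl | rfl)
      · exact ⟨j, h1, by omega, rfl⟩
      · exact ⟨2 * i + 1, by omega, by omega, by ring⟩
      · exact ⟨2 * i + 2, by omega, by omega, by ring⟩
    · rintro ⟨j, h1, h2, rfl⟩
      rcases Nat.lt_or_ge j (2 * i + 1) with h | h
      · exact Or.inl ⟨j, h1, by omega, rfl⟩
      · rcases Nat.lt_or_ge j (2 * i + 2) with h' | h'
        · exact Or.inr (Or.inl (by omega))
        · exact Or.inr (Or.inr (by omega))

/-- No register is written twice by the macro. [folklore] -/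
theorem nodup_filterMap_rdest_mulInstrsUpTo (r₀ x y : ℕ) : ∀ i, ((mulInstrsUpTo r₀ x y i).filterMap Instr.rdest).Nodup
  | 0 => by simp [mulInstrsUpTo]
  | i + 1 => by
    rw [mulInstrsUpTo, List.filterMap_append]
    refine List.Nodup.append (nodup_filterMap_rdest_mulInstrsUpTo r₀ x y i) (by simp [Instr.rdest]) ?_
    intro d hd hd'
    rw [mem_filterMap_rdest_mulInstrsUpTo] at hd
    obtain ⟨j, _, h2, rfl⟩ := hd
    simp only [List.filterMap_cons, Instr.rdest, List.filterMap_nil, List.mem_cons, List.not_mem_nil, or_false] at hd'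
    rcases hd' with h | h <;> omega

/-- The macro contains no `setBit`. [folklore] -/
theorem ne_setBit_of_mem_mulInstrsUpTo (r₀ x y : ℕ) : ∀ (i : ℕ), ∀ ins ∈ mulInstrsUpTo r₀ x y i, ∀ d j, ins ≠ .setBit d j
  | 0, ins, h, _, _ => by simp [mulInstrsUpTo] at h
  | i + 1, ins, h, d, j => by
    rw [mulInstrsUpTo, List.mem_append] at h
    rcases h with h | h
    · exact ne_setBit_of_mem_mulInstrsUpTo r₀ x y i ins h d j
    · simp only [List.mem_cons, List.not_mem_nil, or_false] at h
      rcases h with rfl | rfl <;> exact fun e => by cases e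

/-- The macro writes no flag. [folklore] -/
theorem filterMap_fdest_mulInstrsUpTo (r₀ x y : ℕ) : ∀ i, (mulInstrsUpTo r₀ x y i).filterMap Instr.fdest = []
  | 0 => rfl
  | i + 1 => by rw [mulInstrsUpTo, List.filterMap_append, filterMap_fdest_mulInstrsUpTo r₀ x y i]; rfl

/-- **The macro is well shaped** when its block `r₀, …, r₀ + 2Wd` fits below `R` and the sources are
distinct registers below `r₀`. [folklore] -/
theorem shape_of_mem_mulInstrsUpTo {Wd kIn R F r₀ x y : ℕ} (hx : x < r₀) (hy : y < r₀) (hxy : x ≠ y) :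
    ∀ (i : ℕ), i ≤ Wd → r₀ + 2 * i < R → ∀ ins ∈ mulInstrsUpTo r₀ x y i, ins.Shape Wd kIn R F
  | 0, _, _, ins, h => by simp [mulInstrsUpTo] at h
  | i + 1, hi, hR, ins, h => by
    rw [mulInstrsUpTo, List.mem_append] at h
    rcases h with h | h
    · exact shape_of_mem_mulInstrsUpTo hx hy hxy i (by omega) (by omega) ins h
    · simp only [List.mem_cons, List.not_mem_nil, or_false] at h
      rcases h with rfl | rfl
      · exact ⟨by omega, by omega, by omega, by omega, by omega, hxy, by omega⟩
      · exact ⟨by omega, by omega, by omega, by omega, by omega, by omega⟩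

variable (Wd inp : ℕ)

/-- **Semantics of the rows**: after `i` rows, register `r₀ + 2i` holds `y·(x mod 2^i) mod 2^{Wd}`,
the block beyond it is still clear, registers below `r₀` and beyond the block and all flags are
unchanged. [cite: VedralBarencoEkert1996, §3.3] -/
theorem run_mulInstrsUpTo {r₀ x y : ℕ} (hx : x < r₀) (hy : y < r₀) (st : State)
    (hblock : ∀ j, j ≤ 2 * Wd → st.regs (r₀ + j) = 0) :
    ∀ i, i ≤ Wd →
      (run Wd inp st (mulInstrsUpTo r₀ x y i)).regs (r₀ + 2 * i) = (st.regs y * (st.regs x % 2 ^ i)) % 2 ^ Wd ∧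
      (∀ j, 2 * i < j → j ≤ 2 * Wd → (run Wd inp st (mulInstrsUpTo r₀ x y i)).regs (r₀ + j) = 0) ∧
      (∀ ρ, ρ < r₀ → (run Wd inp st (mulInstrsUpTo r₀ x y i)).regs ρ = st.regs ρ) ∧
      (∀ ρ, r₀ + 2 * Wd < ρ → (run Wd inp st (mulInstrsUpTo r₀ x y i)).regs ρ = st.regs ρ) ∧
      (run Wd inp st (mulInstrsUpTo r₀ x y i)).flags = st.flags
  | 0, _ => by
    refine ⟨?_, fun j hj hj' => ?_, fun ρ _ => rfl, fun ρ _ => rfl, rfl⟩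
    · simp only [mulInstrsUpTo, run, Nat.add_zero, pow_zero, Nat.mod_one, mul_zero, Nat.zero_mod]
      exact hblock 0 (Nat.zero_le _)
    · exact hblock j hj'
  | i + 1, hi => by
    obtain ⟨hacc, hclear, hlow, hhigh, hflags⟩ := run_mulInstrsUpTo hx hy st hblock i (by omega)
    set st₁ := run Wd inp st (mulInstrsUpTo r₀ x y i) with hst₁
    rw [mulInstrsUpTo, run_append, ← hst₁]
    have hxv : st₁.regs x = st.regs x := hlow x hx
    have hyv : st₁.regs y = st.regs y := hlow y hy
    set P := r₀ + 2 * i + 1 with hP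
    set A := r₀ + 2 * i + 2 with hA
    set V := (if (st₁.regs x).testBit i then st₁.regs y else 0) with hV
    have e2 : (run Wd inp st₁ [.andBit P x i y, .add A (r₀ + 2 * i) P i]).regs =
        update (update st₁.regs P V) A ((update st₁.regs P V (r₀ + 2 * i) + update st₁.regs P V P * 2 ^ i) % 2 ^ Wd) := rfl
    have ef : (run Wd inp st₁ [.andBit P x i y, .add A (r₀ + 2 * i) P i]).flags = st₁.flags := rfl
    rw [e2, ef]
    refine ⟨?_, fun j hj hj' => ?_, fun ρ hρ => ?_, fun ρ hρ => ?_, hflags⟩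
    · rw [show r₀ + 2 * (i + 1) = A by rw [hA]; ring, update_self, update_of_ne (show r₀ + 2 * i ≠ P by omega), update_self,
        hacc, hV, hxv, hyv, Nat.add_mod, Nat.mod_mod, ← Nat.add_mod, mul_mod_two_pow_succ]
    · rw [update_of_ne (show r₀ + j ≠ A by omega), update_of_ne (show r₀ + j ≠ P by omega)]; exact hclear j (by omega) hj'
    · rw [update_of_ne (show ρ ≠ A by omega), update_of_ne (show ρ ≠ P by omega)]; exact hlow ρ hρ
    · rw [update_of_ne (show ρ ≠ A by omega), update_of_ne (show ρ ≠ P by omega)]; exact hhigh ρ hρ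

/-- **The multiplication macro multiplies**: from a state bounded by `2^{Wd}` whose block
`r₀, …, r₀ + 2Wd` is clear, `r₀ + 2Wd := x·y mod 2^{Wd}`. [cite: VedralBarencoEkert1996, §3.3] -/
theorem run_mulInstrs {r₀ x y : ℕ} (hx : x < r₀) (hy : y < r₀) (st : State) (hst : ∀ ρ, st.regs ρ < 2 ^ Wd)
    (hblock : ∀ j, j ≤ 2 * Wd → st.regs (r₀ + j) = 0) :
    (run Wd inp st (mulInstrs Wd r₀ x y)).regs (r₀ + 2 * Wd) = (st.regs x * st.regs y) % 2 ^ Wd ∧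
      (∀ ρ, ρ < r₀ → (run Wd inp st (mulInstrs Wd r₀ x y)).regs ρ = st.regs ρ) ∧
      (∀ ρ, r₀ + 2 * Wd < ρ → (run Wd inp st (mulInstrs Wd r₀ x y)).regs ρ = st.regs ρ) ∧
      (run Wd inp st (mulInstrs Wd r₀ x y)).flags = st.flags := by
  obtain ⟨hacc, -, hlow, hhigh, hflags⟩ := run_mulInstrsUpTo Wd inp hx hy st hblock Wd le_rfl
  refine ⟨?_, hlow, hhigh, hflags⟩
  rw [mulInstrs, hacc, Nat.mod_eq_of_lt (hst x), mul_comm]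

end SLP

end Literature.Computability.QuantumComplexity
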